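import Literature.NumberTheory.EllipticCurves.Monsky1990.DescentLemmaCases
import HarnessLib

/-!
# Monsky 1990, Lemma 5.4: from the Galois signs on `√u, √(u + 1), √(u − 1)` to the eight cases

Monsky, *Mock Heegner points and congruent numbers*, Math. Z. 204 (1990), p. 62, proof of Lemma 5.4: "It
follows that `σ` moves `√u` and `√(u + 1)` while `τ` fixes `√u` and moves `√(u + 1)`. Since `−Nv² = u³ − u`,
`u` and `u + 1` are in the subgroup of `ℚ*` generated by `2, p₃, p₅` and the squares. The conditions above
force `u` to be `p₅ (square)` or `2p₅ (square)` and `u + 1` to be `p₃ (square)` or `2p₃ (square)`. Since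
`N = p₃p₅` or `2p₃p₅`, `u − 1 = −(square)` or `−2 (square)`. So eight cases arise."

This file does that bookkeeping in an abstract field `H ⊇ ℚ(i, √2, √p, √q)` with two ring endomorphisms
`σ`, `τ` (the restrictions of Monsky's automorphisms of `ℂ`) and square roots `s₀² = u`, `s₁² = u − 1`,
`sp² = u + 1` of a rational `u ∈ (0, 1)` with `u(u + 1)(u − 1) = −N v²`:

* `map_sqrt_eq_sign_mul`: the sign by which an endomorphism multiplies a square root of a rational number
  is read off the square class `|x| = 2^a p^b q^c w²` of that number;
* `lemma54_field_pos`: the contradiction on `0 < u < 1`, through the square classes of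
  `TwoAdicSquareClasses`, the Galois signs, and the eight cases `DescentLemmaCases.no_solution_of_square_classes`.

The removal of the normalisation `0 < u < 1` (Monsky's translation by the `4`-division point) and Lemma 5.8
are in the sibling `DescentLemmaFields.lean`. Everything is fully proved; no named facts.

## References

* P. Monsky, Mock Heegner points and congruent numbers, Math. Z. 204 (1990) 45–67, Lemma 5.4 (p. 62).
  [Monsky1990MockHeegner]
-/

noncomputable section

namespace Literature.NumberTheory.EllipticCurves.Monsky1990

variable {H : Type*} [Field H] [CharZero H]

/-! ### Square roots of rational square classes and their Galois signs -/

/-- **Galois sign of a square root of a rational square class.** Let `s ∈ H` with `s² = x ∈ ℚ`, where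
`|x| = 2^a p^b q^c w²` (`w ∈ ℚ`), and let `θ₂, θ_p, θ_q, θ_i ∈ H` be square roots of `2, p, q, −1`. If a ring
endomorphism `g` of `H` multiplies `θ₂, θ_p, θ_q, θ_i` by signs `e₂, e_p, e_q, e_i ∈ {±1}`, then
`g s = e₂^a e_p^b e_q^c e_i^n · s`, `n = 0` if `x > 0` and `n = 1` if `x < 0`. (Monsky p. 62: "σ moves √u
…": the action on `√u` is read off from the square class of `u`.)
[cite: Monsky1990MockHeegner, Lemma 5.4 (p. 62), the conditions on u, u + 1, u − 1] -/
theorem map_sqrt_eq_sign_mul (g : H →+* H) {θ₂ θp θq θi : H} {p q : ℕ} (h₂ : θ₂ ^ 2 = 2)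
    (hp : θp ^ 2 = p) (hq : θq ^ 2 = q) (hi : θi ^ 2 = -1) {e₂ ep eq ei : H}
    (hg₂ : g θ₂ = e₂ * θ₂) (hgp : g θp = ep * θp) (hgq : g θq = eq * θq) (hgi : g θi = ei * θi)
    {s : H} {x : ℚ} (hs : s ^ 2 = x) {w : ℚ} {a b c : ℕ} (hx : |x| = 2 ^ a * p ^ b * q ^ c * w ^ 2) :
    (0 < x → g s = e₂ ^ a * ep ^ b * eq ^ c * s) ∧
      (x < 0 → g s = e₂ ^ a * ep ^ b * eq ^ c * ei * s) := by
  -- the model square root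
  set t : H := (w : H) * (θ₂ ^ a * θp ^ b * θq ^ c) with ht
  have ht2 : t ^ 2 = ((|x| : ℚ) : H) := by
    rw [ht, hx]
    push_cast
    rw [mul_pow, mul_pow, mul_pow, ← pow_mul, ← pow_mul, ← pow_mul, mul_comm a 2, mul_comm b 2,
      mul_comm c 2, pow_mul, pow_mul, pow_mul, h₂, hp, hq]
    ring
  have hgt : g t = e₂ ^ a * ep ^ b * eq ^ c * t := by
    rw [ht, map_mul, map_mul, map_mul, map_pow, map_pow, map_pow, hg₂, hgp, hgq, map_ratCast,
      mul_pow, mul_pow, mul_pow]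
    ring
  constructor
  · intro hpos
    have habs : |x| = x := abs_of_pos hpos
    rw [habs] at ht2
    have : s = t ∨ s = -t := sq_eq_sq_iff_eq_or_eq_neg.mp (by rw [hs, ht2])
    rcases this with rfl | rfl
    · exact hgt
    · rw [map_neg, hgt]; ring
  · intro hneg
    have habs : |x| = -x := abs_of_neg hneg
    rw [habs] at ht2
    have h' : (θi * t) ^ 2 = (x : H) := by
      rw [mul_pow, hi, ht2]; push_cast; ring
    have : s = θi * t ∨ s = -(θi * t) := sq_eq_sq_iff_eq_or_eq_neg.mp (by rw [hs, h'])
    rcases this with rfl | rfl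
    · rw [map_mul, hgi, hgt]; ring
    · rw [map_neg, map_mul, hgi, hgt]; ring

/-- `1 ≠ -1` in a field of characteristic zero. [folklore] -/
private theorem one_ne_neg_one' : (1 : H) ≠ -1 := by
  intro h
  have : (2 : H) = 0 := by linear_combination h
  exact two_ne_zero this

/-! ### Lemma 5.4 -/

/-- **Monsky 1990, Lemma 5.4, field form, on `0 < u < 1`.** Primes `p ≡ 5 (8)`, `q ≡ 3 (8)`; `N ∣ 2pq`;
`u ∈ (0, 1)` rational with `u(u + 1)(u − 1) = −N v²`, `v ≠ 0`; `s₀, s₁, sp ∈ H` with `s₀² = u`,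
`s₁² = u − 1`, `sp² = u + 1`; `σ` fixes `i, √2`, moves `√p, √q`; `τ` moves `i, √q`, fixes `√2, √p`; and
`σ s₀ = −s₀`, `σ s₁ = s₁`, `σ sp = −sp`, `τ s₀ = s₀`, `τ s₁ = −s₁`, `τ sp = −sp`. Then `False`.
[cite: Monsky1990MockHeegner, Lemma 5.4 (p. 62)] -/
theorem lemma54_field_pos (σ τ : H →+* H) {θ₂ θp θq θi : H} {p q N : ℕ} (hp : p.Prime) (hq : q.Prime)
    (hp8 : p % 8 = 5) (hq8 : q % 8 = 3) (hN : N ∣ 2 * p * q) (hN0 : N ≠ 0)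
    (h₂ : θ₂ ^ 2 = 2) (hpθ : θp ^ 2 = p) (hqθ : θq ^ 2 = q) (hi : θi ^ 2 = -1)
    (hσ₂ : σ θ₂ = θ₂) (hσp : σ θp = -θp) (hσq : σ θq = -θq) (hσi : σ θi = θi)
    (hτ₂ : τ θ₂ = θ₂) (hτp : τ θp = θp) (hτq : τ θq = -θq) (hτi : τ θi = -θi)
    {u v : ℚ} (hu0 : 0 < u) (hu1 : u < 1) (hv : v ≠ 0)
    (hcubic : u * (u + 1) * (u - 1) = -(N : ℚ) * v ^ 2)
    {s₀ s₁ sp : H} (hs₀ : s₀ ^ 2 = u) (hs₁ : s₁ ^ 2 = ((u - 1 : ℚ) : H)) (hsp : sp ^ 2 = ((u + 1 : ℚ) : H))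
    (hσ0 : σ s₀ = -s₀) (hσ1 : σ s₁ = s₁) (hσ2 : σ sp = -sp)
    (hτ0 : τ s₀ = s₀) (hτ1 : τ s₁ = -s₁) (hτ2 : τ sp = -sp) : False := by
  -- square classes away from `{2, p, q}`
  have hval : ∀ ℓ : ℕ, ℓ.Prime → ℓ ≠ 2 → ℓ ≠ p → ℓ ≠ q →
      Even (padicValRat ℓ u) ∧ Even (padicValRat ℓ (u + 1)) ∧ Even (padicValRat ℓ (u - 1)) := by
    intro ℓ hℓ hℓ2 hℓp hℓq
    haveI := Fact.mk hℓ
    refine even_padicValRat_of_cubic ℓ hN0 ?_ hv hcubic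
    intro hd
    have hd' : ℓ ∣ 2 * (2 * p * q) := dvd_trans hd (mul_dvd_mul_left 2 hN)
    rw [show 2 * (2 * p * q) = 2 * 2 * p * q by ring] at hd'
    rcases (Nat.Prime.dvd_mul hℓ).mp hd' with h' | h'
    · rcases (Nat.Prime.dvd_mul hℓ).mp h' with h'' | h''
      · rcases (Nat.Prime.dvd_mul hℓ).mp h'' with h3 | h3 <;>
          exact hℓ2 ((Nat.prime_dvd_prime_iff_eq hℓ Nat.prime_two).mp h3)
      · exact hℓp ((Nat.prime_dvd_prime_iff_eq hℓ hp).mp h'')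
    · exact hℓq ((Nat.prime_dvd_prime_iff_eq hℓ hq).mp h')
  have hu : u ≠ 0 := hu0.ne'
  have hu1' : u + 1 ≠ 0 := by linarith
  have hu1'' : u - 1 ≠ 0 := by linarith
  obtain ⟨w₁, a₁, b₁, c₁, ha₁, hb₁, hc₁, hw₁⟩ :=
    exists_abs_eq_two_pow_mul_pow_mul_pow_mul_sq hu p q hp hq fun ℓ hℓ h2 hp' hq' =>
      (hval ℓ hℓ h2 hp' hq').1
  obtain ⟨w₂, a₂, b₂, c₂, ha₂, hb₂, hc₂, hw₂⟩ :=
    exists_abs_eq_two_pow_mul_pow_mul_pow_mul_sq hu1' p q hp hq fun ℓ hℓ h2 hp' hq' =>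
      (hval ℓ hℓ h2 hp' hq').2.1
  obtain ⟨w₃, a₃, b₃, c₃, ha₃, hb₃, hc₃, hw₃⟩ :=
    exists_abs_eq_two_pow_mul_pow_mul_pow_mul_sq hu1'' p q hp hq fun ℓ hℓ h2 hp' hq' =>
      (hval ℓ hℓ h2 hp' hq').2.2
  -- the Galois signs (`σ`: `(1, −1, −1, 1)`, `τ`: `(1, 1, −1, −1)`)
  have hσ₂' : σ θ₂ = 1 * θ₂ := by rw [hσ₂, one_mul]
  have hσp' : σ θp = (-1) * θp := by rw [hσp, neg_one_mul]
  have hσq' : σ θq = (-1) * θq := by rw [hσq, neg_one_mul]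
  have hσi' : σ θi = 1 * θi := by rw [hσi, one_mul]
  have hτ₂' : τ θ₂ = 1 * θ₂ := by rw [hτ₂, one_mul]
  have hτp' : τ θp = 1 * θp := by rw [hτp, one_mul]
  have hτq' : τ θq = (-1) * θq := by rw [hτq, neg_one_mul]
  have hτi' : τ θi = (-1) * θi := by rw [hτi, neg_one_mul]
  have hs₀' : s₀ ≠ 0 := by
    intro h; rw [h, zero_pow two_ne_zero] at hs₀
    exact hu (by exact_mod_cast hs₀.symm)
  have hs₁' : s₁ ≠ 0 := by
    intro h; rw [h, zero_pow two_ne_zero] at hs₁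
    exact hu1'' (by exact_mod_cast hs₁.symm)
  have hsp' : sp ≠ 0 := by
    intro h; rw [h, zero_pow two_ne_zero] at hsp
    exact hu1' (by exact_mod_cast hsp.symm)
  -- a sign `ε` with `ε s = −s` is `−1`, with `ε s = s` is `1`
  have key : ∀ {ε s : H}, s ≠ 0 → ε * s = -s → ε = -1 := by
    intro ε s hs h
    have : (ε + 1) * s = 0 := by linear_combination h
    rcases mul_eq_zero.mp this with h' | h'
    · linear_combination h'
    · exact absurd h' hs
  have key' : ∀ {ε s : H}, s ≠ 0 → ε * s = s → ε = 1 := by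
    intro ε s hs h
    have : (ε - 1) * s = 0 := by linear_combination h
    rcases mul_eq_zero.mp this with h' | h'
    · linear_combination h'
    · exact absurd h' hs
  -- `s₀`: `σ` moves, `τ` fixes ⟹ `b₁ = 1`, `c₁ = 0`
  obtain ⟨hσs₀, -⟩ := map_sqrt_eq_sign_mul σ h₂ hpθ hqθ hi hσ₂' hσp' hσq' hσi' hs₀ hw₁
  obtain ⟨hτs₀, -⟩ := map_sqrt_eq_sign_mul τ h₂ hpθ hqθ hi hτ₂' hτp' hτq' hτi' hs₀ hw₁
  have e1 := key hs₀' (by rw [← hσs₀ hu0]; exact hσ0)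
  have e2 := key' hs₀' (by rw [← hτs₀ hu0]; exact hτ0)
  -- `sp`: `σ` moves, `τ` moves ⟹ `b₂ = 0`, `c₂ = 1`
  obtain ⟨hσsp, -⟩ := map_sqrt_eq_sign_mul σ h₂ hpθ hqθ hi hσ₂' hσp' hσq' hσi' hsp hw₂
  obtain ⟨hτsp, -⟩ := map_sqrt_eq_sign_mul τ h₂ hpθ hqθ hi hτ₂' hτp' hτq' hτi' hsp hw₂
  have e3 := key hsp' (by rw [← hσsp (by linarith)]; exact hσ2)
  have e4 := key hsp' (by rw [← hτsp (by linarith)]; exact hτ2)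
  -- `s₁`: `σ` fixes, `τ` moves ⟹ `b₃ = 0`, `c₃ = 0`
  obtain ⟨-, hσs₁⟩ := map_sqrt_eq_sign_mul σ h₂ hpθ hqθ hi hσ₂' hσp' hσq' hσi' hs₁ hw₃
  obtain ⟨-, hτs₁⟩ := map_sqrt_eq_sign_mul τ h₂ hpθ hqθ hi hτ₂' hτp' hτq' hτi' hs₁ hw₃
  have e5 := key' hs₁' (by rw [← hσs₁ (by linarith)]; exact hσ1)
  have e6 := key hs₁' (by rw [← hτs₁ (by linarith)]; exact hτ1)
  -- read off the exponents
  have hb₁1 : b₁ = 1 ∧ c₁ = 0 := by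
    rcases Nat.le_one_iff_eq_zero_or_eq_one.mp hb₁ with rfl | rfl <;>
    rcases Nat.le_one_iff_eq_zero_or_eq_one.mp hc₁ with rfl | rfl
    · norm_num at e1
    · norm_num at e2
    · exact ⟨rfl, rfl⟩
    · norm_num at e2
  have hb₂1 : b₂ = 0 ∧ c₂ = 1 := by
    rcases Nat.le_one_iff_eq_zero_or_eq_one.mp hb₂ with rfl | rfl <;>
    rcases Nat.le_one_iff_eq_zero_or_eq_one.mp hc₂ with rfl | rfl
    · norm_num at e4
    · exact ⟨rfl, rfl⟩
    · norm_num at e4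
    · norm_num at e3
  have hb₃1 : b₃ = 0 ∧ c₃ = 0 := by
    rcases Nat.le_one_iff_eq_zero_or_eq_one.mp hb₃ with rfl | rfl <;>
    rcases Nat.le_one_iff_eq_zero_or_eq_one.mp hc₃ with rfl | rfl
    · exact ⟨rfl, rfl⟩
    · norm_num at e6
    · norm_num at e5
    · norm_num at e6
  obtain ⟨rfl, rfl⟩ := hb₁1
  obtain ⟨rfl, rfl⟩ := hb₂1
  obtain ⟨rfl, rfl⟩ := hb₃1
  -- the eight cases
  rw [abs_of_pos hu0] at hw₁
  rw [abs_of_pos (by linarith : (0 : ℚ) < u + 1)] at hw₂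
  rw [abs_of_neg (by linarith : u - 1 < 0)] at hw₃
  exact no_solution_of_square_classes (r₁ := w₁) (r₂ := w₂) (r₃ := w₃) hp8 hq8 hu0 hu1 ha₁ ha₂ ha₃
    (by rw [hw₁]; ring) (by rw [hw₂]; ring) (by rw [← neg_sub, hw₃]; ring)

end Literature.NumberTheory.EllipticCurves.Monsky1990

end
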